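import Summits.Langlands.Langlands.Theorems.PicardMuOrdinaryMuOrdinaryFamilyRTThorneDefs
import HarnessLib

/-!
# Crux `MuOrdinaryFamilyRT` (stmt-Langlands-13757), line `thorne-minimal-lift`: the kernel-checked reduction
# of the crux to the six registered stubs (Reduction file)

Companion of the landed `…ThorneDefs` (p137392).  Verbatim from the registered skeleton
`Cruxes/MuOrdinaryFamilyRT/Lines/thorne_minimal_lift.lean` (f4aa57de), with the six `sorry`-stubs turned into HYPOTHESES:

* `definiteHostPlus_of` — K1⁺ (`T.stub_definiteHostPlus`: finiteness over weight space + classicality over `F′` of the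
  arithmetic points) from `T.stub_finiteOverWeights`, `T.stub_companions`, `T.stub_thorneLift` (real proof);
* `MuOrdinaryFamilyRT_of_plus` — the crux UNFOLDED (`ResidualHyp → LimitConcl` for generic `f`) from char-zero's landed
  `S.stub_picardInput`, `S.stub_accumulation` (p85419), `S.stub_quadraticDescent`, `S.stub_dictionary` (p85480) and this line's
  `T.stub_minimalFamily`, `T.stub_definiteHostPlus`, `T.stub_remainderPlus` (real proof: dominance is the proved
  `algebraMap_injective_of_ringKrullDim_le`);
* `MuOrdinaryFamilyRT_of_thorneStubs` — the crux BY NAME from the six registered stubs of the line (the two fact stubs feed the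
  landed conditional discharges `stub_picardInput_of` p86963 and `stub_quadraticDescent_of` p90012, with the tree's theorem
  `exists_twist_quadraticSign_holds`).

So the line is CLOSED MODULO its six named stubs, in the tree.  Nothing here discharges a stub.
-/

set_option linter.dupNamespace false

namespace Summit.Langlands.Langlands.Cruxes.MuOrdinaryFamilyRT.ThorneMinimalLift

open scoped NumberField Polynomial Matrix Classical
open Field IsDedekindDomain Polynomial
open Literature.NumberTheory.GaloisRepresentations Literature.NumberTheory.Automorphic
open Summit.Langlands.Langlands.Cruxes.MuOrdinaryFamilyRT.CharZeroDominance

noncomputable section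

/-! ## 5. Composition (kernel-checked): stubs 2–4 give K1 on the enlarged scope; then the landed chain -/

/-- **K1⁺ from finiteness, companions and pointwise lifting** (real proof). -/
theorem definiteHostPlus_of :
    T.stub_finiteOverWeights → T.stub_companions → T.stub_thorneLift → T.stub_definiteHostPlus := by
  intro hfin hcomp hlift f ι e S₀ ρC 𝓕 hgen hin hM hdim hpur hΛ
  have hfin' : Module.Finite 𝓕.Λ 𝓕.R := hfin f ι e S₀ ρC 𝓕 hgen hin hM hdim hpur hΛ
  refine ⟨hfin', ?_⟩
  obtain ⟨F', instF, instNF, instA, instG, hcpt', S', D, E, hdeg, hCM, hrange, hE, hS', hDint, hDacc, hcompanion⟩ :=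
    hcomp f ι e S₀ ρC 𝓕 hgen hin hM hdim hpur hfin'
  exact ⟨F', instF, instNF, instA, hcpt', S', D, E, hdeg, hE, hS', hDint, hDacc,
    fun y hy => hlift f ι e S₀ ρC 𝓕 hgen hin hM hpur F' hcpt' S' hdeg hCM hrange hS' y (hcompanion y hy)⟩

/-- **The reduction** (the crux UNFOLDED, `crux_iff`) — the landed `MuOrdinaryFamilyRT_of` of char-zero-dominance with
`MainClass` replaced by `MainClassPlus` and K2/K1 by K2⁺/K1⁺: outside the main class the conceded remainder; inside it the
minimal family (K2⁺) → K1⁺ (finiteness + classicality over `F'`) → dominance (`algebraMap_injective_of_ringKrullDim_le`,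
proved) → accumulation (`S.stub_accumulation`, landed p85419) → quadratic descent (`S.stub_quadraticDescent`,
landed conditionally p90012) → dictionary (`S.stub_dictionary`, landed p85480). -/
theorem MuOrdinaryFamilyRT_of_plus : S.stub_picardInput → T.stub_minimalFamily → T.stub_definiteHostPlus →
    S.stub_accumulation → S.stub_quadraticDescent → S.stub_dictionary → T.stub_remainderPlus →
    ∀ (f : ℤ[X]) (hcpt : isCompact_glFiniteIntegralLevel 3 (CyclotomicField 3 ℚ)),
      f.natDegree = 4 → (f.map (Int.castRingHom ℚ)).Separable →
        12 ∣ Nat.card (f.map (Int.castRingHom ℚ)).Gal → ResidualHyp f hcpt → LimitConcl f hcpt := by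
  intro h₁ h₂ h₃ h₄ h₅ h₆ h₇ f hcpt hdeg hsep hgal hres
  have hgen : Generic f := ⟨hdeg, hsep, hgal⟩
  -- Stub 1: the Picard representation and its Frobenius traces
  obtain ⟨ι, e, S₀, ρC, hin⟩ := h₁ f hgen
  -- the scope: μ-ordinarity at λ, S₄ image, potentially good reduction away from 3; else the conceded remainder
  by_cases hM : MainClassPlus f S₀ ρC
  swap
  · exact h₇ f hcpt ι e S₀ ρC hgen hin hM hres
  have hS₀ : ∀ v : HeightOneSpectrum (𝓞 K), ((3 : ℕ) : 𝓞 K) ∈ v.asIdeal → v ∈ S₀ := hin.1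
  have htr := hin.2.2
  -- K2⁺: a minimal integral ordinary family of dimension ≥ 4 through ρ_C
  obtain ⟨𝓕, hdim, hpur, hΛ⟩ := h₂ f ι e S₀ ρC hgen hin hM
  -- K1⁺: finiteness over Λ, arithmetic weights, classicality over F'
  obtain ⟨hfin, F', _instF, _instNF, _instA, hcpt', S', D, E, hdegF', hE, hS', hDint, hDacc,
      hclass⟩ := h₃ f ι e S₀ ρC 𝓕 hgen hin hM hdim hpur hΛ
  haveI : Module.Finite 𝓕.Λ 𝓕.R := hfin
  -- DOMINANCE (kernel-checked): Λ ↪ R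
  have hinj : Function.Injective (algebraMap 𝓕.Λ 𝓕.R) :=
    algebraMap_injective_of_ringKrullDim_le 𝓕.dim_le hdim
  -- the Picard point as a ℚ̄₃-valued point of R
  let xq : 𝓕.R →+* PadicAlgCl 3 := 𝓕.j.comp (𝓕.x : 𝓕.R →+* 𝓕.𝒪)
  have hxq : ∀ r, xq r = 𝓕.j (𝓕.x r) := fun r => rfl
  have hdom : ∃ 𝔮 : Ideal 𝓕.R, 𝔮.IsPrime ∧ Ideal.comap (algebraMap 𝓕.Λ 𝓕.R) 𝔮 = ⊥ ∧
      ∀ r ∈ 𝔮, xq r = 0 := by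
    refine ⟨⊥, Ideal.isPrime_bot, ?_, fun r hr => ?_⟩
    · rw [← RingHom.ker_eq_comap_bot]
      exact (RingHom.injective_iff_ker_eq_bot _).mp hinj
    · rw [Ideal.mem_bot] at hr
      rw [hr, map_zero]
  have hxint : ∀ a : 𝓕.Λ, ‖xq (algebraMap 𝓕.Λ 𝓕.R a)‖ ≤ 1 := fun a => by
    rw [hxq]; exact 𝓕.j_norm_le _
  have hDacc' : ∀ M : ℕ, ∃ κ ∈ D, ∀ a : 𝓕.Λ,
      ‖κ a - xq (algebraMap 𝓕.Λ 𝓕.R a)‖ ≤ ((3 : ℝ)⁻¹) ^ M := by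
    intro M
    obtain ⟨κ, hκ, h⟩ := hDacc M
    exact ⟨κ, hκ, fun a => by rw [hxq]; exact h a⟩
  -- the descent datum (a level S over K, uniform in the point)
  obtain ⟨S, hdesc⟩ := h₅ F' hdegF' hcpt hcpt' ι S'
  -- the maximal ideal 𝔐 of ℤ̄ cut out by ι
  obtain ⟨𝔐, h𝔐max, h𝔐3, hdict⟩ := h₆ ι e
  refine ⟨e, 𝔐, S ∪ S₀, h𝔐max, h𝔐3, fun k => ?_⟩
  -- accumulation: an arithmetic point y of R with ‖y − x‖ ≤ 3^{-k} uniformly on R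
  obtain ⟨y, hyD, hyx⟩ := h₄ 𝓕.Λ 𝓕.R xq D E hE hdom hxint hDint hDacc' k
  obtain ⟨ρy, hρyT, hρyirr, P', hP'reg, hP'⟩ := hclass y hyD
  obtain ⟨P, hPreg, hP⟩ := hdesc ρy P' hρyirr hP'reg hP'
  refine ⟨P, hPreg, fun 𝔭 h𝔭 => ?_⟩
  have h𝔭S : 𝔭 ∉ S := fun h => h𝔭 (Finset.mem_union_left _ h)
  have h𝔭S₀ : 𝔭 ∉ S₀ := fun h => h𝔭 (Finset.mem_union_right _ h)
  have h3 : ((3 : ℕ) : 𝓞 K) ∉ 𝔭.asIdeal := fun h => h𝔭S₀ (hS₀ 𝔭 h)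
  obtain ⟨⟨α, t₀, hα, ht₀⟩, hcompat⟩ := hP 𝔭 h𝔭S
  have happrox : ∀ g, ‖FramedRep.trace ρy g - FramedRep.trace ρC g‖ ≤ ((3 : ℝ)⁻¹) ^ k := by
    intro g
    rw [hρyT g, ← 𝓕.x_trace g, ← hxq]
    exact hyx _
  obtain ⟨t, u, ht, hu, hut⟩ :=
    hdict k f ρC ρy 𝔭 α t₀ h3 (htr 𝔭 h𝔭S₀) ((hcompat h3) α hα).2 ht₀ happrox
  exact ⟨α, t, u, hα, ht, hu, hut⟩

/-- **The crux from the six registered stubs of the line** (composition, kernel-checked: the fact debts `T.stub_facts` feed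
the landed conditional stubs of char-zero-dominance — `stub_picardInput_of` p86963, `stub_quadraticDescent_of` p90012 with the
tree's `exists_twist_quadraticSign_holds`, `stub_accumulation` p85419, `stub_dictionary` p85480 — and K1⁺ comes from
`definiteHostPlus_of`).  This is `MuOrdinaryFamilyRT_proof` of the skeleton with its `sorry`s as hypotheses. -/
theorem MuOrdinaryFamilyRT_of_thorneStubs : T.stub_minimalFamily → T.stub_finiteOverWeights → T.stub_companions → T.stub_thorneLift → T.stub_remainderPlus → T.stub_facts → Summit.Langlands.Langlands.Theses.PicardMuOrdinary.MuOrdinaryFamilyRT :=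
  fun h₁ h₂ h₃ h₄ h₅ h₆ =>
    crux_iff.mpr <|
      MuOrdinaryFamilyRT_of_plus (stub_picardInput_of h₆.1) h₁ (definiteHostPlus_of h₂ h₃ h₄) stub_accumulation
        (stub_quadraticDescent_of h₆.2.1 h₆.2.2.1
          Literature.NumberTheory.Automorphic.exists_twist_quadraticSign_holds
          h₆.2.2.2.1 h₆.2.2.2.2.1 h₆.2.2.2.2.2)
        stub_dictionary h₅

end

end Summit.Langlands.Langlands.Cruxes.MuOrdinaryFamilyRT.ThorneMinimalLift
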